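import Mathlib.Algebra.Lie.Free
import Literature.Algebra.Lie.SurfaceLieAlgebra
import Literature.Algebra.Lie.FreeLieAlgebraGrading
import HarnessLib

/-!
# Stub `stub_dTwoIndep` of line `saturated-torsor-descent` for crux
`CongruenceShadows.NilpotentShadowsStandard` (item stmt-SmoothPoincare4-14594)

**`ℤ`-linear independence of the square/tree tuples.** In the free `ℤ`-module
`Fin n → L`, `L = FreeLieAlgebra ℤ (Fin n)`, the four families of degree-`3` tuples
`S(x,y)` (`x < y`), `P(x,y;x,z)` (`y < z`, `x ∉ {y,z}`), `P(x,y;z,w)` and `P(x,z;y,w)` (`x < y < z < w`)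
(the standard spanning set of Levine's `D₂(ℤⁿ) = ker(ℤⁿ ⊗ L₃ → L₄)`) are linearly independent:
if the displayed combination vanishes in every component `j`, all coefficients vanish.

Proof. Apply the canonical Lie morphism `φ = toTensor ℤ (Fin n) : L → ℤ[FreeMonoid (Fin n)]`
(`Literature/Algebra/Lie/FreeLieAlgebraGrading.lean`; letters to letters, injectivity is not
needed) in one component and read the coefficient of one word of length `3`, using
`φ⁅a,⁅b,c⁆⁆ = abc - acb - bca + cba` (`coeff_lie₃`):
* (i) in component `y₀` the word `x₀x₀y₀` (`x₀ < y₀`) receives only `S(x₀,y₀)`, with coefficient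
  `-α x₀ y₀`;
* (ii) in component `y₀` the word `x₀x₀z₀` (`y₀ < z₀`, `x₀ ∉ {y₀,z₀}`) receives only
  `P(x₀,y₀;x₀,z₀)`, with coefficient `-β x₀ y₀ z₀`;
* (iii) in component `w₀` (`x₀ < y₀ < z₀ < w₀`) the word `z₀y₀x₀` receives only `γ x₀ y₀ z₀ w₀`
  and the word `y₀z₀x₀` only `δ x₀ y₀ z₀ w₀` (sorted reading of `⁅z,⁅x,y⁆⁆`, `⁅y,⁅x,z⁆⁆`).
The bookkeeping is pointwise in the summation indices (`DTwoIndep.pointA_i`, …): split the guards,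
kill every other bracket by a letter-count obstruction (`coeff_lie₃_sq/aac/bab/a/b/c`, hypotheses
discharged by `omega` on `Fin n`), and collapse the indicator sums (`sum₂_ite`, …).
Mathlib + `Literature` only; no definitions, no named facts.
-/

-- the prescribed namespace `Summit.<P>.<Sub>.…` duplicates `SmoothPoincare4` (P = Sub)
set_option linter.dupNamespace false

open scoped commutatorElement

namespace Summit.SmoothPoincare4.SmoothPoincare4.Theorems.NilpotentShadowsStandard.SaturatedTorsorDescent

open Literature.Algebra.Lie

namespace DTwoIndep

variable {n : ℕ}

/-- Words of length three in the free monoid are equal iff letterwise equal. [folklore] -/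
theorem freeMonoid_of_mul_eq_iff (a b c p q r : Fin n) :
    FreeMonoid.of a * (FreeMonoid.of b * FreeMonoid.of c) =
      FreeMonoid.of p * (FreeMonoid.of q * FreeMonoid.of r) ↔ a = p ∧ b = q ∧ c = r := by
  rw [← FreeMonoid.toList.apply_eq_iff_eq]
  simp [FreeMonoid.toList_mul, FreeMonoid.toList_of]

/-- **Coefficient formula**: in `T(X) = ℤ⟨X⟩`, `φ⁅a,⁅b,c⁆⁆ = abc - acb - bca + cba`, read at the
word `pqr`. [folklore] -/
theorem coeff_lie₃ (a b c p q r : Fin n) :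
    (toTensor ℤ (Fin n) ⁅FreeLieAlgebra.of ℤ a, ⁅FreeLieAlgebra.of ℤ b, FreeLieAlgebra.of ℤ c⁆⁆).coeff
      (FreeMonoid.of p * FreeMonoid.of q * FreeMonoid.of r) =
    (if a = p ∧ b = q ∧ c = r then 1 else 0) - (if a = p ∧ c = q ∧ b = r then 1 else 0) -
      (if b = p ∧ c = q ∧ a = r then 1 else 0) + (if c = p ∧ b = q ∧ a = r then 1 else 0) := by
  classical
  simp only [LieHom.map_lie, toTensor_of, LieRing.of_associative_ring_bracket, mul_sub, sub_mul,
    MonoidAlgebra.single_mul_single, mul_one, mul_assoc, MonoidAlgebra.coeff_sub, Finsupp.coe_sub,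
    Pi.sub_apply, MonoidAlgebra.coeff_single, Finsupp.single_apply, freeMonoid_of_mul_eq_iff]
  ring

/-- `φ(0)` has no coefficients. [folklore] -/
theorem coeff_toTensor_zero (w : FreeMonoid (Fin n)) :
    (toTensor ℤ (Fin n) 0).coeff w = 0 := by
  rw [map_zero, MonoidAlgebra.coeff_zero, Finsupp.zero_apply]

/-- Coefficients of `φ` are additive. [folklore] -/
theorem coeff_toTensor_add (u v : FreeLieAlgebra ℤ (Fin n)) (w : FreeMonoid (Fin n)) :
    (toTensor ℤ (Fin n) (u + v)).coeff w = (toTensor ℤ (Fin n) u).coeff w + (toTensor ℤ (Fin n) v).coeff w := by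
  rw [map_add, MonoidAlgebra.coeff_add, Finsupp.add_apply]

/-- Coefficients of `φ` respect subtraction. [folklore] -/
theorem coeff_toTensor_sub (u v : FreeLieAlgebra ℤ (Fin n)) (w : FreeMonoid (Fin n)) :
    (toTensor ℤ (Fin n) (u - v)).coeff w = (toTensor ℤ (Fin n) u).coeff w - (toTensor ℤ (Fin n) v).coeff w := by
  rw [map_sub, MonoidAlgebra.coeff_sub, Finsupp.sub_apply]

/-- Coefficients of `φ` respect negation. [folklore] -/
theorem coeff_toTensor_neg (u : FreeLieAlgebra ℤ (Fin n)) (w : FreeMonoid (Fin n)) :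
    (toTensor ℤ (Fin n) (-u)).coeff w = -(toTensor ℤ (Fin n) u).coeff w := by
  rw [map_neg, MonoidAlgebra.coeff_neg, Finsupp.neg_apply]

/-- Coefficients of `φ` are `ℤ`-homogeneous. [folklore] -/
theorem coeff_toTensor_smul (c : ℤ) (u : FreeLieAlgebra ℤ (Fin n)) (w : FreeMonoid (Fin n)) :
    (toTensor ℤ (Fin n) (c • u)).coeff w = c * (toTensor ℤ (Fin n) u).coeff w := by
  rw [map_smul, MonoidAlgebra.coeff_smul, Finsupp.smul_apply, smul_eq_mul]

/-- Coefficients of `φ` commute with finite sums. [folklore] -/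
theorem coeff_toTensor_sum {ι : Type*} (s : Finset ι) (f : ι → FreeLieAlgebra ℤ (Fin n))
    (w : FreeMonoid (Fin n)) :
    (toTensor ℤ (Fin n) (∑ i ∈ s, f i)).coeff w = ∑ i ∈ s, (toTensor ℤ (Fin n) (f i)).coeff w := by
  rw [map_sum, MonoidAlgebra.coeff_sum, Finsupp.finsetSum_apply]

/-- A bracket of three distinct letters has no coefficient at a word `ppr`. [folklore] -/
theorem coeff_lie₃_sq (p r a b c : Fin n) (hab : a ≠ b) (hbc : b ≠ c) (hac : a ≠ c) :
    (toTensor ℤ (Fin n) ⁅FreeLieAlgebra.of ℤ a, ⁅FreeLieAlgebra.of ℤ b, FreeLieAlgebra.of ℤ c⁆⁆).coeff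
      (FreeMonoid.of p * FreeMonoid.of p * FreeMonoid.of r) = 0 := by
  rw [coeff_lie₃]; split_ifs <;> omega

/-- `⁅a,⁅a,c⁆⁆` has no coefficient at a word with distinct letters. [folklore] -/
theorem coeff_lie₃_aac (p q r a c : Fin n) (hpq : p ≠ q) (hqr : q ≠ r) (hpr : p ≠ r) :
    (toTensor ℤ (Fin n) ⁅FreeLieAlgebra.of ℤ a, ⁅FreeLieAlgebra.of ℤ a, FreeLieAlgebra.of ℤ c⁆⁆).coeff
      (FreeMonoid.of p * FreeMonoid.of q * FreeMonoid.of r) = 0 := by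
  rw [coeff_lie₃]; split_ifs <;> omega

/-- `⁅b,⁅a,b⁆⁆` has no coefficient at a word with distinct letters. [folklore] -/
theorem coeff_lie₃_bab (p q r a b : Fin n) (hpq : p ≠ q) (hqr : q ≠ r) (hpr : p ≠ r) :
    (toTensor ℤ (Fin n) ⁅FreeLieAlgebra.of ℤ b, ⁅FreeLieAlgebra.of ℤ a, FreeLieAlgebra.of ℤ b⁆⁆).coeff
      (FreeMonoid.of p * FreeMonoid.of q * FreeMonoid.of r) = 0 := by
  rw [coeff_lie₃]; split_ifs <;> omega

/-- `⁅a,⁅b,c⁆⁆` has no coefficient at `pqr` if `a ∉ {p, r}`. [folklore] -/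
theorem coeff_lie₃_a (p q r a b c : Fin n) (hap : a ≠ p) (har : a ≠ r) :
    (toTensor ℤ (Fin n) ⁅FreeLieAlgebra.of ℤ a, ⁅FreeLieAlgebra.of ℤ b, FreeLieAlgebra.of ℤ c⁆⁆).coeff
      (FreeMonoid.of p * FreeMonoid.of q * FreeMonoid.of r) = 0 := by
  rw [coeff_lie₃]; split_ifs <;> omega

/-- `⁅a,⁅b,c⁆⁆` has no coefficient at `pqr` if `b ∉ {p, q, r}`. [folklore] -/
theorem coeff_lie₃_b (p q r a b c : Fin n) (hbp : b ≠ p) (hbq : b ≠ q) (hbr : b ≠ r) :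
    (toTensor ℤ (Fin n) ⁅FreeLieAlgebra.of ℤ a, ⁅FreeLieAlgebra.of ℤ b, FreeLieAlgebra.of ℤ c⁆⁆).coeff
      (FreeMonoid.of p * FreeMonoid.of q * FreeMonoid.of r) = 0 := by
  rw [coeff_lie₃]; split_ifs <;> omega

/-- `⁅a,⁅b,c⁆⁆` has no coefficient at `pqr` if `c ∉ {p, q, r}`. [folklore] -/
theorem coeff_lie₃_c (p q r a b c : Fin n) (hcp : c ≠ p) (hcq : c ≠ q) (hcr : c ≠ r) :
    (toTensor ℤ (Fin n) ⁅FreeLieAlgebra.of ℤ a, ⁅FreeLieAlgebra.of ℤ b, FreeLieAlgebra.of ℤ c⁆⁆).coeff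
      (FreeMonoid.of p * FreeMonoid.of q * FreeMonoid.of r) = 0 := by
  rw [coeff_lie₃]; split_ifs <;> omega

/-- The coefficient of `⁅p,⁅p,r⁆⁆` at `ppr` (`p ≠ r`) is `1`. [folklore] -/
theorem coeff_lie₃_aac_pos (p r a c : Fin n) (ha : a = p) (hc : c = r) (hpr : p ≠ r) :
    (toTensor ℤ (Fin n) ⁅FreeLieAlgebra.of ℤ a, ⁅FreeLieAlgebra.of ℤ a, FreeLieAlgebra.of ℤ c⁆⁆).coeff
      (FreeMonoid.of p * FreeMonoid.of p * FreeMonoid.of r) = 1 := by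
  rw [coeff_lie₃]; split_ifs <;> omega

/-- `⁅a,⁅a,c⁆⁆` has no coefficient at `ppr` (`p ≠ r`) unless `(a, c) = (p, r)`. [folklore] -/
theorem coeff_lie₃_aac_neg (p r a c : Fin n) (h : ¬(a = p ∧ c = r)) (hpr : p ≠ r) :
    (toTensor ℤ (Fin n) ⁅FreeLieAlgebra.of ℤ a, ⁅FreeLieAlgebra.of ℤ a, FreeLieAlgebra.of ℤ c⁆⁆).coeff
      (FreeMonoid.of p * FreeMonoid.of p * FreeMonoid.of r) = 0 := by
  rw [coeff_lie₃]; split_ifs <;> omega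

/-- Sorted reading, `γ`-word: the coefficient of `⁅z₀,⁅x₀,y₀⁆⁆` at `z₀y₀x₀` (`x₀<y₀<z₀`) is `-1`.
[folklore] -/
theorem coeff_lie₃_zxy_pos (x y z x₀ y₀ z₀ : Fin n) (hx : x = x₀) (hy : y = y₀) (hz : z = z₀)
    (h₁ : x₀ < y₀) (h₂ : y₀ < z₀) :
    (toTensor ℤ (Fin n) ⁅FreeLieAlgebra.of ℤ z, ⁅FreeLieAlgebra.of ℤ x, FreeLieAlgebra.of ℤ y⁆⁆).coeff
      (FreeMonoid.of z₀ * FreeMonoid.of y₀ * FreeMonoid.of x₀) = -1 := by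
  rw [coeff_lie₃]; split_ifs <;> omega

/-- Sorted reading, `γ`-word: `⁅z,⁅x,y⁆⁆` (`x<y<z`) has no coefficient at `z₀y₀x₀` (`x₀<y₀<z₀`)
unless `(x, y, z) = (x₀, y₀, z₀)`. [folklore] -/
theorem coeff_lie₃_zxy_neg (x y z x₀ y₀ z₀ : Fin n) (h : ¬(x = x₀ ∧ y = y₀ ∧ z = z₀)) (hxy : x < y)
    (hyz : y < z) (h₁ : x₀ < y₀) (h₂ : y₀ < z₀) :
    (toTensor ℤ (Fin n) ⁅FreeLieAlgebra.of ℤ z, ⁅FreeLieAlgebra.of ℤ x, FreeLieAlgebra.of ℤ y⁆⁆).coeff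
      (FreeMonoid.of z₀ * FreeMonoid.of y₀ * FreeMonoid.of x₀) = 0 := by
  rw [coeff_lie₃]; split_ifs <;> omega

/-- Sorted reading, `γ`-word: `⁅y,⁅x,z⁆⁆` (`x<y<z`) has no coefficient at `z₀y₀x₀`. [folklore] -/
theorem coeff_lie₃_yxz (x y z x₀ y₀ z₀ : Fin n) (hxy : x < y) (hyz : y < z) (h₁ : x₀ < y₀) (h₂ : y₀ < z₀) :
    (toTensor ℤ (Fin n) ⁅FreeLieAlgebra.of ℤ y, ⁅FreeLieAlgebra.of ℤ x, FreeLieAlgebra.of ℤ z⁆⁆).coeff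
      (FreeMonoid.of z₀ * FreeMonoid.of y₀ * FreeMonoid.of x₀) = 0 := by
  rw [coeff_lie₃]; split_ifs <;> omega

/-- Sorted reading, `δ`-word: the coefficient of `⁅y₀,⁅x₀,z₀⁆⁆` at `y₀z₀x₀` is `-1`. [folklore] -/
theorem coeff_lie₃_yxz_pos' (x y z x₀ y₀ z₀ : Fin n) (hx : x = x₀) (hy : y = y₀) (hz : z = z₀)
    (h₁ : x₀ < y₀) (h₂ : y₀ < z₀) :
    (toTensor ℤ (Fin n) ⁅FreeLieAlgebra.of ℤ y, ⁅FreeLieAlgebra.of ℤ x, FreeLieAlgebra.of ℤ z⁆⁆).coeff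
      (FreeMonoid.of y₀ * FreeMonoid.of z₀ * FreeMonoid.of x₀) = -1 := by
  rw [coeff_lie₃]; split_ifs <;> omega

/-- Sorted reading, `δ`-word: `⁅y,⁅x,z⁆⁆` (`x<y<z`) has no coefficient at `y₀z₀x₀` unless
`(x, y, z) = (x₀, y₀, z₀)`. [folklore] -/
theorem coeff_lie₃_yxz_neg' (x y z x₀ y₀ z₀ : Fin n) (h : ¬(x = x₀ ∧ y = y₀ ∧ z = z₀)) (hxy : x < y)
    (hyz : y < z) (h₁ : x₀ < y₀) (h₂ : y₀ < z₀) :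
    (toTensor ℤ (Fin n) ⁅FreeLieAlgebra.of ℤ y, ⁅FreeLieAlgebra.of ℤ x, FreeLieAlgebra.of ℤ z⁆⁆).coeff
      (FreeMonoid.of y₀ * FreeMonoid.of z₀ * FreeMonoid.of x₀) = 0 := by
  rw [coeff_lie₃]; split_ifs <;> omega

/-- Sorted reading, `δ`-word: `⁅z,⁅x,y⁆⁆` has no coefficient at `y₀z₀x₀`. [folklore] -/
theorem coeff_lie₃_zxy' (x y z x₀ y₀ z₀ : Fin n) (hxy : x < y) (hyz : y < z) (h₁ : x₀ < y₀) (h₂ : y₀ < z₀) :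
    (toTensor ℤ (Fin n) ⁅FreeLieAlgebra.of ℤ z, ⁅FreeLieAlgebra.of ℤ x, FreeLieAlgebra.of ℤ y⁆⁆).coeff
      (FreeMonoid.of y₀ * FreeMonoid.of z₀ * FreeMonoid.of x₀) = 0 := by
  rw [coeff_lie₃]; split_ifs <;> omega

/-- Collapsing a double sum over an indicator. [folklore] -/
theorem sum₂_ite (f : Fin n → Fin n → ℤ) (a b : Fin n) :
    (∑ x, ∑ y, if x = a ∧ y = b then f x y else 0) = f a b := by
  rw [Finset.sum_eq_single a, Finset.sum_eq_single b]
  · simp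
  · intro y _ hy; simp [hy]
  · simp
  · intro x _ hx; exact Finset.sum_eq_zero fun y _ => by simp [hx]
  · simp

/-- Collapsing a triple sum over an indicator. [folklore] -/
theorem sum₃_ite (f : Fin n → Fin n → Fin n → ℤ) (a b c : Fin n) :
    (∑ x, ∑ y, ∑ z, if x = a ∧ y = b ∧ z = c then f x y z else 0) = f a b c := by
  rw [Finset.sum_eq_single a]
  · have := sum₂_ite (f a) b c
    simpa using this
  · intro x _ hx; exact Finset.sum_eq_zero fun y _ => Finset.sum_eq_zero fun z _ => by simp [hx]
  · simp

/-- Collapsing a quadruple sum over an indicator. [folklore] -/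
theorem sum₄_ite (f : Fin n → Fin n → Fin n → Fin n → ℤ) (a b c d : Fin n) :
    (∑ x, ∑ y, ∑ z, ∑ w, if x = a ∧ y = b ∧ z = c ∧ w = d then f x y z w else 0) = f a b c d := by
  rw [Finset.sum_eq_single a]
  · have := sum₃_ite (f a) b c d
    simpa using this
  · intro x _ hx
    exact Finset.sum_eq_zero fun y _ => Finset.sum_eq_zero fun z _ => Finset.sum_eq_zero fun w _ => by simp [hx]
  · simp

/-- Part (i), family `S`: in component `y₀` only `S(x₀,y₀)` has a coefficient at the word
`x₀x₀y₀`, namely `-α x₀ y₀`. [folklore] -/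
theorem pointA_i (α : Fin n → Fin n → ℤ) (x₀ y₀ : Fin n) (h₀ : x₀ < y₀) (x y : Fin n) :
    (toTensor ℤ (Fin n) (if x < y then α x y • ((if y₀ = x then ⁅FreeLieAlgebra.of ℤ y, ⁅FreeLieAlgebra.of ℤ x, FreeLieAlgebra.of ℤ y⁆⁆ else 0) - (if y₀ = y then ⁅FreeLieAlgebra.of ℤ x, ⁅FreeLieAlgebra.of ℤ x, FreeLieAlgebra.of ℤ y⁆⁆ else 0)) else (0 : FreeLieAlgebra ℤ (Fin n)))).coeff
      (FreeMonoid.of x₀ * FreeMonoid.of x₀ * FreeMonoid.of y₀) = if x = x₀ ∧ y = y₀ then -α x y else 0 := by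
  split_ifs <;> (try omega) <;>
    simp (disch := omega) only [coeff_toTensor_zero, coeff_toTensor_smul, coeff_toTensor_neg,
      coeff_lie₃_a, coeff_lie₃_aac_pos, mul_zero, mul_one, mul_neg, sub_zero, zero_sub,
      neg_zero, sub_self]

/-- Part (i), family `P(x,y;x,z)`: no coefficient at `x₀x₀y₀` in component `y₀`. [folklore] -/
theorem pointB_i (β : Fin n → Fin n → Fin n → ℤ) (x₀ y₀ : Fin n) (h₀ : x₀ < y₀) (x y z : Fin n) :
    (toTensor ℤ (Fin n) (if y < z ∧ x ≠ y ∧ x ≠ z then β x y z • ((if y₀ = x then ⁅FreeLieAlgebra.of ℤ y, ⁅FreeLieAlgebra.of ℤ x, FreeLieAlgebra.of ℤ z⁆⁆ else 0) - (if y₀ = y then ⁅FreeLieAlgebra.of ℤ x, ⁅FreeLieAlgebra.of ℤ x, FreeLieAlgebra.of ℤ z⁆⁆ else 0) + (if y₀ = x then ⁅FreeLieAlgebra.of ℤ z, ⁅FreeLieAlgebra.of ℤ x, FreeLieAlgebra.of ℤ y⁆⁆ else 0) - (if y₀ = z then ⁅FreeLieAlgebra.of ℤ x, ⁅FreeLieAlgebra.of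 ℤ x, FreeLieAlgebra.of ℤ y⁆⁆ else 0)) else 0)).coeff
      (FreeMonoid.of x₀ * FreeMonoid.of x₀ * FreeMonoid.of y₀) = 0 := by
  split_ifs <;> (try omega) <;>
    simp (disch := omega) only [coeff_toTensor_zero, coeff_toTensor_smul, coeff_toTensor_add,
      coeff_toTensor_neg, coeff_lie₃_sq, coeff_lie₃_c, coeff_lie₃_aac_neg, mul_zero, sub_zero,
      zero_sub, add_zero, neg_zero, sub_self]

/-- Families `P(x,y;z,w)`, `P(x,z;y,w)` (distinct letters): no coefficient at any word `ppr`, in any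
component. [folklore] -/
theorem pointC_sq (γ δ : Fin n → Fin n → Fin n → Fin n → ℤ) (j p r : Fin n) (x y z w : Fin n) :
    (toTensor ℤ (Fin n) (if x < y ∧ y < z ∧ z < w then
          γ x y z w • ((if j = x then ⁅FreeLieAlgebra.of ℤ y, ⁅FreeLieAlgebra.of ℤ z, FreeLieAlgebra.of ℤ w⁆⁆ else 0) - (if j = y then ⁅FreeLieAlgebra.of ℤ x, ⁅FreeLieAlgebra.of ℤ z, FreeLieAlgebra.of ℤ w⁆⁆ else 0) + (if j = z then ⁅FreeLieAlgebra.of ℤ w, ⁅FreeLieAlgebra.of ℤ x, FreeLieAlgebra.of ℤ y⁆⁆ else 0) - (if j = w then ⁅FreeLieAlgebra.of ℤ z, ⁅FreeLieAlgebra.of ℤ x, FreeLieAlgebra.of ℤ y⁆⁆ else 0)) +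
          δ x y z w • ((if j = x then ⁅FreeLieAlgebra.of ℤ z, ⁅FreeLieAlgebra.of ℤ y, FreeLieAlgebra.of ℤ w⁆⁆ else 0) - (if j = z then ⁅FreeLieAlgebra.of ℤ x, ⁅FreeLieAlgebra.of ℤ y, FreeLieAlgebra.of ℤ w⁆⁆ else 0) + (if j = y then ⁅FreeLieAlgebra.of ℤ w, ⁅FreeLieAlgebra.of ℤ x, FreeLieAlgebra.of ℤ z⁆⁆ else 0) - (if j = w then ⁅FreeLieAlgebra.of ℤ y, ⁅FreeLieAlgebra.of ℤ x, FreeLieAlgebra.of ℤ z⁆⁆ else 0)) else 0)).coeff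
      (FreeMonoid.of p * FreeMonoid.of p * FreeMonoid.of r) = 0 := by
  split_ifs <;> (try omega) <;>
    simp (disch := omega) only [coeff_toTensor_zero, coeff_toTensor_smul, coeff_toTensor_add,
      coeff_toTensor_neg, coeff_lie₃_sq, mul_zero, sub_zero, zero_sub, add_zero, zero_add,
      neg_zero, sub_self]

/-- Part (ii), family `S`: no coefficient at `x₀x₀z₀` in component `y₀`. [folklore] -/
theorem pointA_ii (α : Fin n → Fin n → ℤ) (x₀ y₀ z₀ : Fin n) (h₁ : y₀ < z₀) (h₂ : x₀ ≠ y₀) (h₃ : x₀ ≠ z₀)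
    (x y : Fin n) :
    (toTensor ℤ (Fin n) (if x < y then α x y • ((if y₀ = x then ⁅FreeLieAlgebra.of ℤ y, ⁅FreeLieAlgebra.of ℤ x, FreeLieAlgebra.of ℤ y⁆⁆ else 0) - (if y₀ = y then ⁅FreeLieAlgebra.of ℤ x, ⁅FreeLieAlgebra.of ℤ x, FreeLieAlgebra.of ℤ y⁆⁆ else 0)) else (0 : FreeLieAlgebra ℤ (Fin n)))).coeff
      (FreeMonoid.of x₀ * FreeMonoid.of x₀ * FreeMonoid.of z₀) = 0 := by
  split_ifs <;> (try omega) <;>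
    simp (disch := omega) only [coeff_toTensor_zero, coeff_toTensor_smul, coeff_toTensor_neg,
      coeff_lie₃_b, coeff_lie₃_c, mul_zero, sub_zero, zero_sub, neg_zero, sub_self]

/-- Part (ii), family `P(x,y;x,z)`: in component `y₀` only `P(x₀,y₀;x₀,z₀)` has a coefficient at
`x₀x₀z₀`, namely `-β x₀ y₀ z₀`. [folklore] -/
theorem pointB_ii (β : Fin n → Fin n → Fin n → ℤ) (x₀ y₀ z₀ : Fin n) (h₁ : y₀ < z₀) (h₂ : x₀ ≠ y₀)
    (h₃ : x₀ ≠ z₀) (x y z : Fin n) :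
    (toTensor ℤ (Fin n) (if y < z ∧ x ≠ y ∧ x ≠ z then β x y z • ((if y₀ = x then ⁅FreeLieAlgebra.of ℤ y, ⁅FreeLieAlgebra.of ℤ x, FreeLieAlgebra.of ℤ z⁆⁆ else 0) - (if y₀ = y then ⁅FreeLieAlgebra.of ℤ x, ⁅FreeLieAlgebra.of ℤ x, FreeLieAlgebra.of ℤ z⁆⁆ else 0) + (if y₀ = x then ⁅FreeLieAlgebra.of ℤ z, ⁅FreeLieAlgebra.of ℤ x, FreeLieAlgebra.of ℤ y⁆⁆ else 0) - (if y₀ = z then ⁅FreeLieAlgebra.of ℤ x, ⁅FreeLieAlgebra.of ℤ x, FreeLieAlgebra.of ℤ y⁆⁆ else 0)) else 0)).coeff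
      (FreeMonoid.of x₀ * FreeMonoid.of x₀ * FreeMonoid.of z₀) =
      if x = x₀ ∧ y = y₀ ∧ z = z₀ then -β x y z else 0 := by
  split_ifs <;> (try omega) <;>
    simp (disch := omega) only [coeff_toTensor_zero, coeff_toTensor_smul, coeff_toTensor_add,
      coeff_toTensor_neg, coeff_lie₃_sq, coeff_lie₃_aac_pos, coeff_lie₃_aac_neg, mul_zero,
      mul_one, mul_neg, sub_zero, zero_sub, add_zero, neg_zero, sub_self]

/-- Part (iii), family `S` (a repeated letter): no coefficient at a word with distinct letters.
[folklore] -/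
theorem pointA_dist (α : Fin n → Fin n → ℤ) (j p q r : Fin n) (hpq : p ≠ q) (hqr : q ≠ r) (hpr : p ≠ r)
    (x y : Fin n) :
    (toTensor ℤ (Fin n) (if x < y then α x y • ((if j = x then ⁅FreeLieAlgebra.of ℤ y, ⁅FreeLieAlgebra.of ℤ x, FreeLieAlgebra.of ℤ y⁆⁆ else 0) - (if j = y then ⁅FreeLieAlgebra.of ℤ x, ⁅FreeLieAlgebra.of ℤ x, FreeLieAlgebra.of ℤ y⁆⁆ else 0)) else (0 : FreeLieAlgebra ℤ (Fin n)))).coeff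
      (FreeMonoid.of p * FreeMonoid.of q * FreeMonoid.of r) = 0 := by
  split_ifs <;> (try omega) <;>
    simp (disch := omega) only [coeff_toTensor_zero, coeff_toTensor_smul, coeff_toTensor_neg,
      coeff_lie₃_aac, coeff_lie₃_bab, mul_zero, sub_zero, zero_sub, neg_zero, sub_self]

/-- Part (iii), family `P(x,y;x,z)`: no coefficient at a word with distinct letters avoiding the
component index. [folklore] -/
theorem pointB_dist (β : Fin n → Fin n → Fin n → ℤ) (j p q r : Fin n) (hpq : p ≠ q) (hqr : q ≠ r)
    (hpr : p ≠ r) (hjp : j ≠ p) (hjq : j ≠ q) (hjr : j ≠ r) (x y z : Fin n) :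
    (toTensor ℤ (Fin n) (if y < z ∧ x ≠ y ∧ x ≠ z then β x y z • ((if j = x then ⁅FreeLieAlgebra.of ℤ y, ⁅FreeLieAlgebra.of ℤ x, FreeLieAlgebra.of ℤ z⁆⁆ else 0) - (if j = y then ⁅FreeLieAlgebra.of ℤ x, ⁅FreeLieAlgebra.of ℤ x, FreeLieAlgebra.of ℤ z⁆⁆ else 0) + (if j = x then ⁅FreeLieAlgebra.of ℤ z, ⁅FreeLieAlgebra.of ℤ x, FreeLieAlgebra.of ℤ y⁆⁆ else 0) - (if j = z then ⁅FreeLieAlgebra.of ℤ x, ⁅FreeLieAlgebra.of ℤ x, FreeLieAlgebra.of ℤ y⁆⁆ else 0)) else 0)).coeff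
      (FreeMonoid.of p * FreeMonoid.of q * FreeMonoid.of r) = 0 := by
  split_ifs <;> (try omega) <;>
    simp (disch := omega) only [coeff_toTensor_zero, coeff_toTensor_smul, coeff_toTensor_add,
      coeff_toTensor_neg, coeff_lie₃_aac, coeff_lie₃_b, mul_zero, sub_zero, zero_sub, add_zero,
      neg_zero, sub_self]

/-- Part (iii), `γ`: in component `w₀` the coefficient at `z₀y₀x₀` isolates `γ x₀ y₀ z₀ w₀`.
[folklore] -/
theorem pointC_γ (γ δ : Fin n → Fin n → Fin n → Fin n → ℤ) (x₀ y₀ z₀ w₀ : Fin n) (h₁ : x₀ < y₀)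
    (h₂ : y₀ < z₀) (h₃ : z₀ < w₀) (x y z w : Fin n) :
    (toTensor ℤ (Fin n) (if x < y ∧ y < z ∧ z < w then
          γ x y z w • ((if w₀ = x then ⁅FreeLieAlgebra.of ℤ y, ⁅FreeLieAlgebra.of ℤ z, FreeLieAlgebra.of ℤ w⁆⁆ else 0) - (if w₀ = y then ⁅FreeLieAlgebra.of ℤ x, ⁅FreeLieAlgebra.of ℤ z, FreeLieAlgebra.of ℤ w⁆⁆ else 0) + (if w₀ = z then ⁅FreeLieAlgebra.of ℤ w, ⁅FreeLieAlgebra.of ℤ x, FreeLieAlgebra.of ℤ y⁆⁆ else 0) - (if w₀ = w then ⁅FreeLieAlgebra.of ℤ z, ⁅FreeLieAlgebra.of ℤ x, FreeLieAlgebra.of ℤ y⁆⁆ else 0)) +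
          δ x y z w • ((if w₀ = x then ⁅FreeLieAlgebra.of ℤ z, ⁅FreeLieAlgebra.of ℤ y, FreeLieAlgebra.of ℤ w⁆⁆ else 0) - (if w₀ = z then ⁅FreeLieAlgebra.of ℤ x, ⁅FreeLieAlgebra.of ℤ y, FreeLieAlgebra.of ℤ w⁆⁆ else 0) + (if w₀ = y then ⁅FreeLieAlgebra.of ℤ w, ⁅FreeLieAlgebra.of ℤ x, FreeLieAlgebra.of ℤ z⁆⁆ else 0) - (if w₀ = w then ⁅FreeLieAlgebra.of ℤ y, ⁅FreeLieAlgebra.of ℤ x, FreeLieAlgebra.of ℤ z⁆⁆ else 0)) else 0)).coeff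
      (FreeMonoid.of z₀ * FreeMonoid.of y₀ * FreeMonoid.of x₀) =
      if x = x₀ ∧ y = y₀ ∧ z = z₀ ∧ w = w₀ then γ x y z w else 0 := by
  split_ifs <;> (try omega) <;>
    simp (disch := omega) only [coeff_toTensor_zero, coeff_toTensor_smul, coeff_toTensor_add,
      coeff_toTensor_neg, coeff_lie₃_a, coeff_lie₃_b, coeff_lie₃_c, coeff_lie₃_zxy_pos,
      coeff_lie₃_zxy_neg, coeff_lie₃_yxz, mul_zero, mul_one, neg_neg, sub_zero, zero_sub,
      add_zero, zero_add, neg_zero, sub_self]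

/-- Part (iii), `δ`: in component `w₀` the coefficient at `y₀z₀x₀` isolates `δ x₀ y₀ z₀ w₀`.
[folklore] -/
theorem pointC_δ (γ δ : Fin n → Fin n → Fin n → Fin n → ℤ) (x₀ y₀ z₀ w₀ : Fin n) (h₁ : x₀ < y₀)
    (h₂ : y₀ < z₀) (h₃ : z₀ < w₀) (x y z w : Fin n) :
    (toTensor ℤ (Fin n) (if x < y ∧ y < z ∧ z < w then
          γ x y z w • ((if w₀ = x then ⁅FreeLieAlgebra.of ℤ y, ⁅FreeLieAlgebra.of ℤ z, FreeLieAlgebra.of ℤ w⁆⁆ else 0) - (if w₀ = y then ⁅FreeLieAlgebra.of ℤ x, ⁅FreeLieAlgebra.of ℤ z, FreeLieAlgebra.of ℤ w⁆⁆ else 0) + (if w₀ = z then ⁅FreeLieAlgebra.of ℤ w, ⁅FreeLieAlgebra.of ℤ x, FreeLieAlgebra.of ℤ y⁆⁆ else 0) - (if w₀ = w then ⁅FreeLieAlgebra.of ℤ z, ⁅FreeLieAlgebra.of ℤ x, FreeLieAlgebra.of ℤ y⁆⁆ else 0)) +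
          δ x y z w • ((if w₀ = x then ⁅FreeLieAlgebra.of ℤ z, ⁅FreeLieAlgebra.of ℤ y, FreeLieAlgebra.of ℤ w⁆⁆ else 0) - (if w₀ = z then ⁅FreeLieAlgebra.of ℤ x, ⁅FreeLieAlgebra.of ℤ y, FreeLieAlgebra.of ℤ w⁆⁆ else 0) + (if w₀ = y then ⁅FreeLieAlgebra.of ℤ w, ⁅FreeLieAlgebra.of ℤ x, FreeLieAlgebra.of ℤ z⁆⁆ else 0) - (if w₀ = w then ⁅FreeLieAlgebra.of ℤ y, ⁅FreeLieAlgebra.of ℤ x, FreeLieAlgebra.of ℤ z⁆⁆ else 0)) else 0)).coeff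
      (FreeMonoid.of y₀ * FreeMonoid.of z₀ * FreeMonoid.of x₀) =
      if x = x₀ ∧ y = y₀ ∧ z = z₀ ∧ w = w₀ then δ x y z w else 0 := by
  split_ifs <;> (try omega) <;>
    simp (disch := omega) only [coeff_toTensor_zero, coeff_toTensor_smul, coeff_toTensor_add,
      coeff_toTensor_neg, coeff_lie₃_a, coeff_lie₃_b, coeff_lie₃_c, coeff_lie₃_yxz_pos',
      coeff_lie₃_yxz_neg', coeff_lie₃_zxy', mul_zero, mul_one, neg_neg, sub_zero, zero_sub,
      add_zero, zero_add, neg_zero, sub_self]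

end DTwoIndep

open DTwoIndep in
/-- Stub 4b · **`ℤ`-linear independence of the square/tree tuples of `D₂(ℤⁿ)`**. The four families
`S(x,y)` (`x<y`), `P(x,y;x,z)` (`y<z`, `x∉{y,z}`), `P(x,y;z,w)`, `P(x,z;y,w)` (`x<y<z<w`) of degree-`3`
tuples in `Fin n → L(ℤⁿ)` (the standard spanning set of Levine's `D₂(H) = ker(H ⊗ L₃ → L₄)`) are
linearly independent: a vanishing `ℤ`-combination has all coefficients zero. Proof: apply the Lie
morphism `φ : L(ℤⁿ) → ℤ⟨X⟩` (`Literature.Algebra.Lie.toTensor`, letters to letters) in a chosen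
component and read the coefficient of a chosen word of length `3`
(`φ⁅a,⁅b,c⁆⁆ = abc - acb - bca + cba`): the word `x₀x₀y₀` in component `y₀` sees only `S(x₀,y₀)`
(coefficient `-α`), the word `x₀x₀z₀` in component `y₀` sees only `P(x₀,y₀;x₀,z₀)` (coefficient
`-β`), and in component `w₀` the words `z₀y₀x₀`, `y₀z₀x₀` isolate `γ`, `δ` of `(x₀,y₀,z₀,w₀)`.
[folklore] -/
theorem stub_dTwoIndep : ∀ n : ℕ, ∀ (α : Fin n → Fin n → ℤ) (β : Fin n → Fin n → Fin n → ℤ) (γ δ : Fin n → Fin n → Fin n → Fin n → ℤ), (∀ j : Fin n,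
        (∑ x, ∑ y, if x < y then α x y • ((if j = x then ⁅FreeLieAlgebra.of ℤ y, ⁅FreeLieAlgebra.of ℤ x, FreeLieAlgebra.of ℤ y⁆⁆ else 0) - (if j = y then ⁅FreeLieAlgebra.of ℤ x, ⁅FreeLieAlgebra.of ℤ x, FreeLieAlgebra.of ℤ y⁆⁆ else 0)) else (0 : FreeLieAlgebra ℤ (Fin n))) +
        (∑ x, ∑ y, ∑ z, if y < z ∧ x ≠ y ∧ x ≠ z then β x y z • ((if j = x then ⁅FreeLieAlgebra.of ℤ y, ⁅FreeLieAlgebra.of ℤ x, FreeLieAlgebra.of ℤ z⁆⁆ else 0) - (if j = y then ⁅FreeLieAlgebra.of ℤ x, ⁅FreeLieAlgebra.of ℤ x, FreeLieAlgebra.of ℤ z⁆⁆ else 0) + (if j = x then ⁅FreeLieAlgebra.of ℤ z, ⁅FreeLieAlgebra.of ℤ x, FreeLieAlgebra.of ℤ y⁆⁆ else 0) - (if j = z then ⁅FreeLieAlgebra.of ℤ x, ⁅FreeLieAlgebra.of ℤ x, FreeLieAlgebra.of ℤ y⁆⁆ else 0)) else 0) +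
        (∑ x, ∑ y, ∑ z, ∑ w, if x < y ∧ y < z ∧ z < w then
          γ x y z w • ((if j = x then ⁅FreeLieAlgebra.of ℤ y, ⁅FreeLieAlgebra.of ℤ z, FreeLieAlgebra.of ℤ w⁆⁆ else 0) - (if j = y then ⁅FreeLieAlgebra.of ℤ x, ⁅FreeLieAlgebra.of ℤ z, FreeLieAlgebra.of ℤ w⁆⁆ else 0) + (if j = z then ⁅FreeLieAlgebra.of ℤ w, ⁅FreeLieAlgebra.of ℤ x, FreeLieAlgebra.of ℤ y⁆⁆ else 0) - (if j = w then ⁅FreeLieAlgebra.of ℤ z, ⁅FreeLieAlgebra.of ℤ x, FreeLieAlgebra.of ℤ y⁆⁆ else 0)) +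
          δ x y z w • ((if j = x then ⁅FreeLieAlgebra.of ℤ z, ⁅FreeLieAlgebra.of ℤ y, FreeLieAlgebra.of ℤ w⁆⁆ else 0) - (if j = z then ⁅FreeLieAlgebra.of ℤ x, ⁅FreeLieAlgebra.of ℤ y, FreeLieAlgebra.of ℤ w⁆⁆ else 0) + (if j = y then ⁅FreeLieAlgebra.of ℤ w, ⁅FreeLieAlgebra.of ℤ x, FreeLieAlgebra.of ℤ z⁆⁆ else 0) - (if j = w then ⁅FreeLieAlgebra.of ℤ y, ⁅FreeLieAlgebra.of ℤ x, FreeLieAlgebra.of ℤ z⁆⁆ else 0)) else 0) = 0) →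
      (∀ x y, x < y → α x y = 0) ∧ (∀ x y z, y < z → x ≠ y → x ≠ z → β x y z = 0) ∧ (∀ x y z w, x < y → y < z → z < w → γ x y z w = 0 ∧ δ x y z w = 0) := by
  intro n α β γ δ h
  refine ⟨fun x₀ y₀ hxy => ?_, fun x₀ y₀ z₀ hyz hxy hxz => ?_, fun x₀ y₀ z₀ w₀ hxy hyz hzw => ⟨?_, ?_⟩⟩
  · -- (i) read the word `x₀ x₀ y₀` in component `y₀`
    have key := congrArg (fun u => (toTensor ℤ (Fin n) u).coeff
      (FreeMonoid.of x₀ * FreeMonoid.of x₀ * FreeMonoid.of y₀)) (h y₀)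
    simp only [coeff_toTensor_add, coeff_toTensor_sum, coeff_toTensor_zero, pointA_i α x₀ y₀ hxy,
      pointB_i β x₀ y₀ hxy, pointC_sq γ δ, Finset.sum_const_zero, add_zero, sum₂_ite] at key
    omega
  · -- (ii) read the word `x₀ x₀ z₀` in component `y₀`
    have key := congrArg (fun u => (toTensor ℤ (Fin n) u).coeff
      (FreeMonoid.of x₀ * FreeMonoid.of x₀ * FreeMonoid.of z₀)) (h y₀)
    simp only [coeff_toTensor_add, coeff_toTensor_sum, coeff_toTensor_zero,
      pointA_ii α x₀ y₀ z₀ hyz hxy hxz, pointB_ii β x₀ y₀ z₀ hyz hxy hxz, pointC_sq γ δ,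
      Finset.sum_const_zero, add_zero, zero_add, sum₃_ite] at key
    omega
  · -- (iii, γ) read the word `z₀ y₀ x₀` in component `w₀`
    have key := congrArg (fun u => (toTensor ℤ (Fin n) u).coeff
      (FreeMonoid.of z₀ * FreeMonoid.of y₀ * FreeMonoid.of x₀)) (h w₀)
    simp only [coeff_toTensor_add, coeff_toTensor_sum, coeff_toTensor_zero,
      pointA_dist α w₀ z₀ y₀ x₀ (by omega) (by omega) (by omega),
      pointB_dist β w₀ z₀ y₀ x₀ (by omega) (by omega) (by omega) (by omega) (by omega) (by omega),
      pointC_γ γ δ x₀ y₀ z₀ w₀ hxy hyz hzw, Finset.sum_const_zero, zero_add, sum₄_ite] at key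
    exact key
  · -- (iii, δ) read the word `y₀ z₀ x₀` in component `w₀`
    have key := congrArg (fun u => (toTensor ℤ (Fin n) u).coeff
      (FreeMonoid.of y₀ * FreeMonoid.of z₀ * FreeMonoid.of x₀)) (h w₀)
    simp only [coeff_toTensor_add, coeff_toTensor_sum, coeff_toTensor_zero,
      pointA_dist α w₀ y₀ z₀ x₀ (by omega) (by omega) (by omega),
      pointB_dist β w₀ y₀ z₀ x₀ (by omega) (by omega) (by omega) (by omega) (by omega) (by omega),
      pointC_δ γ δ x₀ y₀ z₀ w₀ hxy hyz hzw, Finset.sum_const_zero, zero_add, sum₄_ite] at key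
    exact key

end Summit.SmoothPoincare4.SmoothPoincare4.Theorems.NilpotentShadowsStandard.SaturatedTorsorDescent
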